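import Mathlib.Analysis.InnerProductSpace.Calculus
import Mathlib.Analysis.Calculus.ContDiff.Operations
import Mathlib.Analysis.SpecificLimits.Normed
import Mathlib.Topology.Algebra.Module.FiniteDimension
import Mathlib.LinearAlgebra.FiniteDimensional.Basic
import HarnessLib

/-!
# Smooth coefficients from pointwise spanning (the Gram construction)

Analysis/Hypoelliptic support file serving the discharge of
`Literature.Analysis.Distribution.Hormander1967_thm11` (turning Hörmander's pointwise bracket
condition into smooth coefficient functions near a point).

For smooth vector fields `Z_1, …, Z_m` on a finite-dimensional inner product space `V` whose
values span `V` at `y₀`: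

* the Gram operator `M(y) v = ∑_i ⟪Z_i y, v⟫ Z_i y` is smooth and invertible near `y₀`
  (`gramOp`, `isUnit_gramOp`, `isOpen_gramUnit`);
* the coefficients `g_{k,i}(y) = ⟪Z_i y, M(y)⁻¹ e_k⟫` are smooth where `M` is invertible and
  `∑_i g_{k,i}(y) Z_i(y) = e_k` there (`gramCoef`, `sum_gramCoef_smul`, `contDiffAt_gramCoef`);
* **`exists_gram`**: a ball around `y₀` on which every vector `e_k` is a smooth combination of the
  `Z_i`;
* `contDiff_cutoff_mul`: a cutoff supported inside an open set times a function smooth on that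
  set is smooth.

## References

* L. Hörmander, Acta Math. 119 (1967), p. 149 ("we can choose … as linear combinations with
  `C^∞` coefficients"); folklore.
-/

noncomputable section

open Set Filter Function Metric
open scoped Topology InnerProductSpace BigOperators ContDiff

namespace Literature.Analysis.Hypoelliptic

variable {V : Type*} [NormedAddCommGroup V] [InnerProductSpace ℝ V]
variable {m : ℕ} (Z : Fin m → V → V)

/-! ### The Gram operator -/

/-- The Gram operator `M(y) v = ∑_i ⟪Z_i y, v⟫ Z_i y`. [folklore] -/
def gramOp (y : V) : V →L[ℝ] V := ∑ i, (innerSL ℝ (Z i y)).smulRight (Z i y)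

/-- Pointwise formula. [folklore] -/
theorem gramOp_apply (y v : V) : gramOp Z y v = ∑ i, ⟪Z i y, v⟫_ℝ • Z i y := by
  simp [gramOp, ContinuousLinearMap.smulRight_apply]

variable {Z}

/-- The Gram operator is smooth. [folklore] -/
theorem contDiff_gramOp (hZ : ∀ i, ContDiff ℝ ∞ (Z i)) : ContDiff ℝ ∞ (gramOp Z) := by
  unfold gramOp
  refine ContDiff.sum fun i _ => ?_
  exact ContDiff.smulRight ((innerSL ℝ).contDiff.comp (hZ i)) (hZ i)

/-- `⟪M v, v⟫ = ∑_i ⟪Z_i, v⟫²`. [folklore] -/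
theorem inner_gramOp_self (y v : V) : ⟪gramOp Z y v, v⟫_ℝ = ∑ i, ⟪Z i y, v⟫_ℝ ^ 2 := by
  rw [gramOp_apply, sum_inner]
  refine Finset.sum_congr rfl fun i _ => ?_
  rw [real_inner_smul_left]; ring

/-- Spanning values make the Gram operator injective. [folklore] -/
theorem injective_gramOp {y : V} (h : Submodule.span ℝ (Set.range fun i => Z i y) = ⊤) :
    Function.Injective (gramOp Z y) := by
  intro v w hvw
  set u := v - w with hu
  have h0 : gramOp Z y u = 0 := by rw [hu, map_sub, hvw, sub_self]
  -- `⟪Z_i y, u⟫ = 0` for all `i`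
  have hsum : ∑ i, ⟪Z i y, u⟫_ℝ ^ 2 = 0 := by rw [← inner_gramOp_self, h0, inner_zero_left]
  have hZi : ∀ i, ⟪Z i y, u⟫_ℝ = 0 := fun i => by
    have := (Finset.sum_eq_zero_iff_of_nonneg fun j _ => sq_nonneg (⟪Z j y, u⟫_ℝ)).1 hsum i (Finset.mem_univ i)
    exact pow_eq_zero_iff (n := 2) (by norm_num) |>.1 this
  -- hence `u ⊥ span = ⊤`, so `u = 0`
  have hmem : u ∈ Submodule.span ℝ (Set.range fun i => Z i y) := by rw [h]; exact Submodule.mem_top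
  have horth : ∀ x ∈ Submodule.span ℝ (Set.range fun i => Z i y), ⟪x, u⟫_ℝ = 0 := by
    intro x hx
    induction hx using Submodule.span_induction with
    | mem x hx => obtain ⟨i, rfl⟩ := hx; exact hZi i
    | zero => exact inner_zero_left _
    | add x x' _ _ hx hx' => rw [inner_add_left, hx, hx', add_zero]
    | smul c x _ hx => rw [real_inner_smul_left, hx, mul_zero]
  have hu0 : u = 0 := by
    have := horth u hmem
    rwa [real_inner_self_eq_norm_sq, pow_eq_zero_iff (by norm_num), norm_eq_zero] at this
  exact sub_eq_zero.1 hu0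

variable [FiniteDimensional ℝ V]

/-- **Spanning values make the Gram operator a unit.** [folklore] -/
theorem isUnit_gramOp {y : V} (h : Submodule.span ℝ (Set.range fun i => Z i y) = ⊤) :
    IsUnit (gramOp Z y) := by
  haveI : CompleteSpace V := FiniteDimensional.complete ℝ V
  rw [ContinuousLinearMap.isUnit_iff_isUnit_toLinearMap, LinearMap.isUnit_iff_ker_eq_bot,
    LinearMap.ker_eq_bot]
  exact injective_gramOp h

/-- The set where the Gram operator is a unit is open. [folklore] -/
theorem isOpen_gramUnit (hZ : ∀ i, ContDiff ℝ ∞ (Z i)) : IsOpen {y : V | IsUnit (gramOp Z y)} := by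
  haveI : CompleteSpace V := FiniteDimensional.complete ℝ V
  exact Units.isOpen.preimage (contDiff_gramOp hZ).continuous

/-! ### The coefficients -/

/-- The Gram coefficients `g_{k,i}(y) = ⟪Z_i y, M(y)⁻¹ e_k⟫`. [folklore] -/
def gramCoef {n : ℕ} (e : Fin n → V) (k : Fin n) (i : Fin m) (y : V) : ℝ :=
  ⟪Z i y, Ring.inverse (gramOp Z y) (e k)⟫_ℝ

omit [FiniteDimensional ℝ V] in
/-- **`∑_i g_{k,i}(y) Z_i(y) = e_k`** where the Gram operator is a unit. [folklore] -/
theorem sum_gramCoef_smul {n : ℕ} (e : Fin n → V) (k : Fin n) {y : V} (hU : IsUnit (gramOp Z y)) :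
    ∑ i, gramCoef (Z := Z) e k i y • Z i y = e k := by
  unfold gramCoef
  rw [← gramOp_apply]
  have := Ring.mul_inverse_cancel _ hU
  have h2 := congrArg (fun f : V →L[ℝ] V => f (e k)) this
  simpa using h2

/-- The coefficients are smooth where the Gram operator is a unit. [folklore] -/
theorem contDiffAt_gramCoef (hZ : ∀ i, ContDiff ℝ ∞ (Z i)) {n : ℕ} (e : Fin n → V) (k : Fin n) (i : Fin m)
    {y : V} (hU : IsUnit (gramOp Z y)) : ContDiffAt ℝ ∞ (gramCoef (Z := Z) e k i) y := by
  haveI : CompleteSpace V := FiniteDimensional.complete ℝ V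
  unfold gramCoef
  obtain ⟨x, hx⟩ := hU
  have hinv : ContDiffAt ℝ ∞ (fun y => Ring.inverse (gramOp Z y)) y := by
    have h1 : ContDiffAt ℝ ∞ Ring.inverse (gramOp Z y) := by rw [← hx]; exact contDiffAt_ringInverse ℝ x
    exact h1.comp y (contDiff_gramOp hZ).contDiffAt
  exact ((hZ i).contDiffAt).inner ℝ (hinv.clm_apply contDiffAt_const)

/-- **Smooth local coefficients from pointwise spanning**: if the values of the smooth fields
`Z_i` span `V` at `y₀` then on a ball around `y₀` every vector `e_k` is a combination
`∑_i g_{k,i} Z_i` with coefficients smooth on the ball. [folklore] -/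
theorem exists_gram (hZ : ∀ i, ContDiff ℝ ∞ (Z i)) {y₀ : V}
    (hspan : Submodule.span ℝ (Set.range fun i => Z i y₀) = ⊤) {n : ℕ} (e : Fin n → V) :
    ∃ δ₀ : ℝ, 0 < δ₀ ∧ ∃ g : Fin n → Fin m → V → ℝ,
      (∀ k i, ∀ y ∈ ball y₀ δ₀, ContDiffAt ℝ ∞ (g k i) y) ∧
      ∀ y ∈ ball y₀ δ₀, ∀ k, ∑ i, g k i y • Z i y = e k := by
  have hO := isOpen_gramUnit hZ
  have hy₀ : y₀ ∈ {y : V | IsUnit (gramOp Z y)} := isUnit_gramOp hspan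
  obtain ⟨δ₀, hδ₀, hball⟩ := Metric.isOpen_iff.1 hO y₀ hy₀
  refine ⟨δ₀, hδ₀, gramCoef (Z := Z) e, fun k i y hy => contDiffAt_gramCoef hZ e k i (hball hy),
    fun y hy k => sum_gramCoef_smul e k (hball hy)⟩

/-! ### Cutoffs times locally smooth functions -/

omit [FiniteDimensional ℝ V] in
/-- A cutoff supported inside an open set times a function smooth on that set is smooth.
[folklore] -/
theorem contDiff_cutoff_mul {ρ g : V → ℝ} (hρ : ContDiff ℝ ∞ ρ) {U : Set V}
    (hsupp : tsupport ρ ⊆ U) (hg : ∀ y ∈ U, ContDiffAt ℝ ∞ g y) :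
    ContDiff ℝ ∞ (fun y => ρ y * g y) := by
  refine contDiff_iff_contDiffAt.2 fun y => ?_
  by_cases hy : y ∈ tsupport ρ
  · exact hρ.contDiffAt.mul (hg y (hsupp hy))
  · -- `ρ g = 0` near `y`
    have hev : (fun z => ρ z * g z) =ᶠ[𝓝 y] fun _ => 0 := by
      have h0 : ρ =ᶠ[𝓝 y] 0 := notMem_tsupport_iff_eventuallyEq.1 hy
      filter_upwards [h0] with z hz
      simp [hz]
    exact (contDiffAt_const (c := (0 : ℝ))).congr_of_eventuallyEq hev

end Literature.Analysis.Hypoelliptic
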